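import Summits.BirchSwinnertonDyer.Rank1Residual.X11b.BDPRouteShaAn
import Summits.BirchSwinnertonDyer.Rank1Residual.X2.TwistTamagawa
import Literature.NumberTheory.EllipticCurves.QuadraticTwistLocalPolynomialProofs
import HarnessLib

/-!
# Route `SchneiderFreeAdditiveX3` (rung K1 door, cell `bsd-schneider-ideate`), crux `JointLowerManin`
# — helper 2: the three `c`-robust transports (Tamagawa inequality, `v_p(u) ≥ 0`, the twist's
# algebraic central value from Gross–Zagier I.(7.3))

Helpers toward item `stmt-BirchSwinnertonDyer-19180` (`JointLowerManin`, route
`route-BirchSwinnertonDyer-SchneiderFreeAdditiveX3`, rev 3). The tree leaf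
`SchneiderFree.JointLowerOfStepLManin` quantifies over EVERY odd prime `p` (no `p ∣ N`, no `p ∤ d_K`)
and EVERY globally minimal model `Wd = Cd • E^{(d_K)}` of the twist, so the Gross–Zagier bookkeeping
cannot use the tree's EQUALITIES `ord_p ∏c_ℓ(E^{d_K}) = ord_p ∏c_ℓ(E)` (`X2.…_of_heegner_of_odd`,
needs `p ∤ d_K`) and `ord_p u(Cd) = 0` (`X11b.…_of_splitsIn`, needs `p` split). For the JOINT LOWER
half only the INEQUALITIES are needed, and they hold unconditionally:

* `padicValNat_tamagawaProduct_le_twist_of_heegner` — `ord_p ∏_ℓ c_ℓ(E) ≤ ord_p ∏_ℓ c_ℓ(E^{(d_K)})`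
  for ANY prime `p`, `K` imaginary quadratic with the Heegner hypothesis for `N_E`, ANY model `Wd` of
  the twist: at `ℓ ∣ N_E` the two curves are `ℚ_ℓ`-isomorphic (`d_K ∈ (ℚ_ℓ^×)²`,
  `X11b.isSquare_discr_padic_of_heegner`), so `c_ℓ(Wd) = c_ℓ(W)`; at `ℓ ∤ N_E`, `c_ℓ(W) = 1`.
* `padicValRat_u_nonneg_of_twist_minimal_of_odd` — `0 ≤ ord_p u(Cd)` for `p` odd, `W` globally
  minimal, `Wd = Cd • W^{(d)}` globally minimal, `d ∈ ℤ`: the twist model `W^{(d)}` is `ℤ_p`-integral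
  (`isIntegral_quadraticTwist`, `2 ∈ ℤ_p^×`), `Wd ⊗ ℚ_p` is `ℤ_p`-minimal, so `v_p(Δ(Wd)) ≤ v_p(Δ(W^{(d)}))`
  (Mathlib's `IsMinimal.val_Δ_maximal`), i.e. `12·v_p(u) ≥ 0`.
* `exists_rat_twist_L_one_div_realPeriod_of_heegner` — the twist's algebraic central value
  `L(E^{d_K},1)/Ω(Wd) ∈ ℚ` from Gross–Zagier I.(7.3) 2) (`L'(E,1) = c·Ω·Reg`, `c ∈ ℚ^×`) and the
  Gross–Zagier product formula `L'(E,1)·L(E^{d_K},1) = ‖ω‖² ĥ(P_K)/(c_φ² u_K² √|d_K|)` with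
  `ĥ(P_K) = 2 I² Reg/(m t_K²)`: `L(E^{d_K},1)/Ω(Wd) = 8 I²/(n m c_φ² w² t_K² c |u|)`.

THEOREMS ONLY; the published inputs are binders. HONEST FRAMING: helpers for a crux item of a DRAFT
route; nothing here touches the rung leaf or BSD.

References: [JetchevSkinnerWan2017] §7.3.1 (eq:tamK), §7.4.1 (pp. 29–31 of arXiv:1512.06894);
[GrossZagier1986] Thm. I.(7.3), V.§2; [SilvermanAEC2009] VII.1 Prop. 1.3, X.5 Cor. 5.4;
[CesnaviciusNeururerSaha2020] arXiv:1911.09446 Thm. 1.2.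
-/

noncomputable section

open scoped Classical

open WeierstrassCurve NumberField IsDedekindDomain Rat.HeightOneSpectrum
  Literature.NumberTheory.EllipticCurves
  Literature.NumberTheory.EllipticCurves.ModularForms
  Literature.NumberTheory.EllipticCurves.Rank1Residual
  Literature.NumberTheory.EllipticCurves.KrizLi2019
  Literature.NumberTheory.QuadraticFields Summit.BirchSwinnertonDyer.Rank1Residual

namespace Summit.BirchSwinnertonDyer.BirchSwinnertonDyer.Theorems.SchneiderFree

/-! ### (β) The Tamagawa inequality along the Heegner twist -/

/-- `ord_p` of a finite product of non-zero naturals is the sum of the `ord_p`. [folklore] -/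
private theorem padicValNat_finset_prod_aux (p : ℕ) [Fact p.Prime] {ι : Type*} (s : Finset ι)
    (f : ι → ℕ) (hf : ∀ i ∈ s, f i ≠ 0) :
    padicValNat p (∏ i ∈ s, f i) = ∑ i ∈ s, padicValNat p (f i) := by
  induction s using Finset.induction_on with
  | empty => simp
  | insert a s ha ih =>
    rw [Finset.prod_insert ha, Finset.sum_insert ha,
      padicValNat.mul (hf a (Finset.mem_insert_self a s))
        (Finset.prod_ne_zero_iff.mpr fun i hi => hf i (Finset.mem_insert_of_mem hi)),
      ih fun i hi => hf i (Finset.mem_insert_of_mem hi)]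

/-- **`ord_p c_ℓ(E) ≤ ord_p c_ℓ(E^{(d_K)})` at every prime `ℓ`, for ANY prime `p`**, `K` imaginary
quadratic in which every prime of the conductor `N` of `W` splits, `Wd = Cd • W^{(d_K)}` any equation
of the twist: at `ℓ ∣ N`, `d_K ∈ (ℚ_ℓ^×)²` and the curves are `ℚ_ℓ`-isomorphic, so `c_ℓ(Wd) = c_ℓ(W)`;
at `ℓ ∤ N`, `W` is good at `ℓ` and `c_ℓ(W) = 1`. [cite: JetchevSkinnerWan2017, §7.4.1 (eq:tamK)]
[cite: SilvermanAEC2009, X.5 Cor. 5.4] -/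
theorem padicValNat_localTamagawaNumber_le_twist_of_heegner (W : WeierstrassCurve ℚ) [W.IsElliptic]
    [W.IsGloballyMinimal] (p : ℕ) [Fact p.Prime] (K : Type) [Field K] [NumberField K]
    (hK : IsImaginaryQuadratic K) (hH : SatisfiesHeegnerHypothesis (W.conductorNorm ℤ) K)
    {Wd : WeierstrassCurve ℚ} [Wd.IsElliptic] (Cd : VariableChange ℚ)
    (hWd : Cd • W.quadraticTwist (NumberField.discr K : ℚ) = Wd) (ℓ : ℕ) [Fact ℓ.Prime] :
    padicValNat p ((W.baseChange ℚ_[ℓ]).localTamagawaNumber ℤ_[ℓ]) ≤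
      padicValNat p ((Wd.baseChange ℚ_[ℓ]).localTamagawaNumber ℤ_[ℓ]) := by
  set d : ℤ := NumberField.discr K with hd_def
  have hdZ : d ≠ 0 := NumberField.discr_ne_zero K
  have hD0 : (d : ℚ) ≠ 0 := by exact_mod_cast hdZ
  haveI : (W.baseChange ℚ_[ℓ]).IsElliptic :=
    inferInstanceAs (W.map (algebraMap ℚ ℚ_[ℓ])).IsElliptic
  haveI : (Wd.baseChange ℚ_[ℓ]).IsElliptic :=
    inferInstanceAs (Wd.map (algebraMap ℚ ℚ_[ℓ])).IsElliptic
  haveI : (W.quadraticTwist (d : ℚ)).IsElliptic := W.isElliptic_quadraticTwist hD0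
  by_cases hℓN : ℓ ∣ W.conductorNorm ℤ
  · -- `ℓ ∣ N`: `d_K` is a square in `ℚ_ℓ`, the two curves are `ℚ_ℓ`-isomorphic
    obtain ⟨θ, hθ⟩ := X11b.isSquare_discr_padic_of_heegner K hK hH ℓ hℓN
    have hθ0 : θ ≠ 0 := by
      rintro rfl
      exact (map_ne_zero (algebraMap ℚ ℚ_[ℓ])).mpr hD0 (hθ.trans (mul_zero 0))
    obtain ⟨C, hC⟩ := (W.baseChange ℚ_[ℓ]).exists_variableChange_smul_eq_quadraticTwist_sq hθ0
    have h1 : (W.quadraticTwist (d : ℚ)).baseChange ℚ_[ℓ] = C • W.baseChange ℚ_[ℓ] := by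
      rw [hC, baseChange, baseChange, map_quadraticTwist, hθ, sq]
    have hYX : Wd.baseChange ℚ_[ℓ] = (Cd.map (algebraMap ℚ ℚ_[ℓ]) * C) • W.baseChange ℚ_[ℓ] := by
      rw [← hWd, WeierstrassCurve.VariableChange.baseChange_smul_eq (W.quadraticTwist (d : ℚ)) Cd ℚ_[ℓ],
        h1, mul_smul]
    rw [hYX, localTamagawaNumber_variableChange_holds ℤ_[ℓ] (W.baseChange ℚ_[ℓ])
      (Cd.map (algebraMap ℚ ℚ_[ℓ]) * C)]
  · -- `ℓ ∤ N`: `W` is good at `ℓ`, `c_ℓ(W) = 1`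
    have hgood : W.HasGoodReductionAtPrime ℓ := by
      by_contra h
      exact hℓN ((W.dvd_conductorNorm_iff_not_hasGoodReductionAtPrime ℓ).mpr h)
    have hcW : (W.baseChange ℚ_[ℓ]).localTamagawaNumber ℤ_[ℓ] = 1 := by
      haveI : ((W.baseChange ℚ_[ℓ]).minimal ℤ_[ℓ]).HasGoodReduction ℤ_[ℓ] := hgood
      exact localTamagawaNumber_eq_one_of_hasGoodReduction_holds ℤ_[ℓ] _
    rw [hcW, padicValNat_one_right]
    exact Nat.zero_le _

/-- **Transport (β): `ord_p ∏_ℓ c_ℓ(E) ≤ ord_p ∏_ℓ c_ℓ(E^{(d_K)})`** for ANY prime `p`, `K` imaginary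
quadratic satisfying the Heegner hypothesis for the conductor of the globally minimal `W`, and ANY
equation `Wd = Cd • W^{(d_K)}` of the twist. Both Tamagawa products are finite products of local
Tamagawa numbers over the union of the bad places (`tamagawaProduct_eq_prod`), compared prime by prime
(`padicValNat_localTamagawaNumber_le_twist_of_heegner`). The EQUALITY (Jetchev–Skinner–Wan (eq:tamK),
tree `X2.padicValNat_tamagawaProduct_twist_of_heegner_of_odd`) needs `p ∤ d_K`; the inequality does
not. [cite: JetchevSkinnerWan2017, §7.4.1 (eq:tamK) (pp. 29–31)] -/
theorem padicValNat_tamagawaProduct_le_twist_of_heegner (W : WeierstrassCurve ℚ) [W.IsElliptic]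
    [W.IsGloballyMinimal] (p : ℕ) [Fact p.Prime] (K : Type) [Field K] [NumberField K]
    (hK : IsImaginaryQuadratic K) (hH : SatisfiesHeegnerHypothesis (W.conductorNorm ℤ) K)
    {Wd : WeierstrassCurve ℚ} [Wd.IsElliptic] (Cd : VariableChange ℚ)
    (hWd : Cd • W.quadraticTwist (NumberField.discr K : ℚ) = Wd) :
    padicValNat p W.tamagawaProduct ≤ padicValNat p Wd.tamagawaProduct := by
  have hfW : (W.badPlaces ℤ).Finite := W.finite_badPlaces_holds ℤ
  have hfWd : (Wd.badPlaces ℤ).Finite := Wd.finite_badPlaces_holds ℤ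
  set s : Finset (IsDedekindDomain.HeightOneSpectrum ℤ) := hfW.toFinset ∪ hfWd.toFinset with hs
  have hsW : ∀ v, ¬ W.HasGoodReductionAt v → v ∈ s := fun v hv ↦
    Finset.mem_union_left _ (by rw [Set.Finite.mem_toFinset, mem_badPlaces_iff]; exact hv)
  have hsWd : ∀ v, ¬ Wd.HasGoodReductionAt v → v ∈ s := fun v hv ↦
    Finset.mem_union_right _ (by rw [Set.Finite.mem_toFinset, mem_badPlaces_iff]; exact hv)
  rw [tamagawaProduct_eq_prod W s hsW, tamagawaProduct_eq_prod Wd s hsWd,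
    padicValNat_finset_prod_aux p s _ fun v _ ↦ ?_, padicValNat_finset_prod_aux p s _ fun v _ ↦ ?_]
  · refine Finset.sum_le_sum fun v _ ↦ ?_
    haveI := Fact.mk (primesEquiv v).2
    exact padicValNat_localTamagawaNumber_le_twist_of_heegner W p K hK hH Cd hWd (primesEquiv v)
  · haveI := Fact.mk (primesEquiv v).2
    haveI : (Wd.baseChange ℚ_[primesEquiv v]).IsElliptic :=
      inferInstanceAs (Wd.map (algebraMap ℚ ℚ_[primesEquiv v])).IsElliptic
    exact localTamagawaNumber_padic_ne_zero_holds (primesEquiv v) _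
  · haveI := Fact.mk (primesEquiv v).2
    haveI : (W.baseChange ℚ_[primesEquiv v]).IsElliptic :=
      inferInstanceAs (W.map (algebraMap ℚ ℚ_[primesEquiv v])).IsElliptic
    exact localTamagawaNumber_padic_ne_zero_holds (primesEquiv v) _

/-! ### (α) The unit of a minimal model of the twist is a `p`-adic integer at odd `p` -/

/-- `2 ∈ ℤ_pˣ` for odd `p`. [folklore] -/
private theorem isUnit_two_padicInt_aux (p : ℕ) [Fact p.Prime] (hp2 : p ≠ 2) :
    IsUnit (2 : ℤ_[p]) := by
  rw [PadicInt.isUnit_iff, show (2 : ℤ_[p]) = ((2 : ℕ) : ℤ_[p]) by norm_cast,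
    PadicInt.norm_natCast_eq_one_iff]
  exact (Nat.coprime_primes Fact.out Nat.prime_two).mpr hp2

/-- **Transport (α): `0 ≤ ord_p u(Cd)` at an odd prime `p`** for `W/ℚ` globally minimal, `d ∈ ℤ`,
and a globally minimal model `Wd = Cd • W^{(d)}` of the twist. The twist model `W^{(d)} ⊗ ℚ_p` is
`ℤ_p`-integral (`isIntegral_quadraticTwist`: its coefficients are `d b₂/4, d² b₄/2, d³ b₆/4` and
`2 ∈ ℤ_p^×`), `Wd ⊗ ℚ_p` is `ℤ_p`-minimal (`isMinimal_map_padic_of_isGloballyMinimal`), so by the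
definition of minimality `v_p(Δ(Wd)) ≤ v_p(Δ(W^{(d)}))`; with `Δ(Wd) = u⁻¹² Δ(W^{(d)})` this is
`12·v_p(u) ≥ 0`. (The equality `v_p(u) = 0` — tree `X11b.padicValRat_u_eq_zero_of_twist_minimal_of_splitsIn`
— needs `p` split in `ℚ(√d)`; the inequality does not.) [cite: SilvermanAEC2009, VII.1 Prop. 1.3]
[cite: SilvermanAEC2009, X.5 Cor. 5.4] -/
theorem padicValRat_u_nonneg_of_twist_minimal_of_odd (W : WeierstrassCurve ℚ) [W.IsElliptic]
    [W.IsGloballyMinimal] (p : ℕ) [Fact p.Prime] (hp2 : p ≠ 2) (d : ℤ) (hd : d ≠ 0)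
    {Wd : WeierstrassCurve ℚ} [Wd.IsElliptic] [Wd.IsGloballyMinimal] (Cd : VariableChange ℚ)
    (hWd : Cd • W.quadraticTwist (d : ℚ) = Wd) :
    0 ≤ padicValRat p (Cd.u : ℚ) := by
  have hp : p.Prime := Fact.out
  have hD0 : (d : ℚ) ≠ 0 := by exact_mod_cast hd
  haveI : (W.quadraticTwist (d : ℚ)).IsElliptic := W.isElliptic_quadraticTwist hD0
  set X : WeierstrassCurve ℚ_[p] := W.baseChange ℚ_[p] with hX
  set Y : WeierstrassCurve ℚ_[p] := Wd.baseChange ℚ_[p] with hY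
  haveI hXmin : X.IsMinimal ℤ_[p] := isMinimal_map_padic_of_isGloballyMinimal W p
  haveI hYmin : Y.IsMinimal ℤ_[p] := isMinimal_map_padic_of_isGloballyMinimal Wd p
  haveI : Y.IsElliptic := inferInstanceAs (Wd.map (algebraMap ℚ ℚ_[p])).IsElliptic
  -- the `ℤ_p`-integral twist model
  set T : WeierstrassCurve ℚ_[p] := X.quadraticTwist (algebraMap ℤ_[p] ℚ_[p] (d : ℤ_[p])) with hT
  haveI hTint : T.IsIntegral ℤ_[p] :=
    isIntegral_quadraticTwist ℤ_[p] X (isUnit_two_padicInt_aux p hp2) (d : ℤ_[p])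
  have hdK : algebraMap ℤ_[p] ℚ_[p] (d : ℤ_[p]) = algebraMap ℚ ℚ_[p] (d : ℚ) := by simp
  have hTW : (W.quadraticTwist (d : ℚ)).baseChange ℚ_[p] = T := by
    rw [hT, hX, baseChange, baseChange, map_quadraticTwist, hdK]
  set C : VariableChange ℚ_[p] := Cd.map (algebraMap ℚ ℚ_[p]) with hC
  have hYT : Y = C • T := by
    rw [hY, ← hWd, WeierstrassCurve.VariableChange.baseChange_smul_eq (W.quadraticTwist (d : ℚ)) Cd ℚ_[p],
      hTW]
  have hTY : C⁻¹ • Y = T := by rw [hYT, inv_smul_smul]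
  -- minimality of `Y`: the integral model `T = C⁻¹ • Y` has `v(Δ(T)) ≤ v(Δ(Y))`
  have hle : valuation_Δ_aux ℤ_[p] (C⁻¹ • Y) ≤ valuation_Δ_aux ℤ_[p] ((1 : VariableChange ℚ_[p]) • Y) := by
    have hmax := hYmin.val_Δ_maximal
    have hint : IsIntegral ℤ_[p] (C⁻¹ • Y) := by rw [hTY]; exact hTint
    rcases le_total (valuation_Δ_aux ℤ_[p] ((1 : VariableChange ℚ_[p]) • Y))
        (valuation_Δ_aux ℤ_[p] (C⁻¹ • Y)) with h | h
    · exact hmax.2 hint h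
    · exact h
  set V := IsDedekindDomain.HeightOneSpectrum.valuation ℚ_[p]
    (IsDiscreteValuationRing.maximalIdeal ℤ_[p]) with hV
  have hv : V T.Δ ≤ V Y.Δ := by
    have h := Subtype.coe_le_coe.mpr hle
    rw [one_smul, hTY, valuation_Δ_aux_eq_of_isIntegral, valuation_Δ_aux_eq_of_isIntegral] at h
    exact h
  -- `Δ(Y) = u⁻¹² Δ(T)`
  have hYΔ : Y.Δ = (↑C.u⁻¹ : ℚ_[p]) ^ 12 * T.Δ := by rw [hYT, variableChange_Δ]
  have hTΔ0 : V T.Δ ≠ 0 := by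
    have hT0 : T.Δ ≠ 0 := by
      rw [← hTW, baseChange, map_Δ]
      exact (map_ne_zero _).mpr (W.quadraticTwist (d : ℚ)).isUnit_Δ.ne_zero
    exact (Valuation.ne_zero_iff V).mpr hT0
  rw [hYΔ, map_mul, map_pow] at hv
  -- `1 ≤ V(u⁻¹)^12`, hence `V(u) ≤ 1`
  have h1 : 1 ≤ V (↑C.u⁻¹ : ℚ_[p]) ^ 12 := by
    by_contra hlt
    push Not at hlt
    have : V (↑C.u⁻¹ : ℚ_[p]) ^ 12 * V T.Δ < 1 * V T.Δ :=
      mul_lt_mul_of_pos_right hlt (zero_lt_iff.mpr hTΔ0)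
    rw [one_mul] at this
    exact absurd hv (not_le.mpr this)
  have hu0 : (C.u : ℚ_[p]) ≠ 0 := C.u.ne_zero
  have hVu : V (C.u : ℚ_[p]) ≤ 1 := by
    by_contra hgt
    push Not at hgt
    have hinv : V (↑C.u⁻¹ : ℚ_[p]) < 1 := by
      rw [Units.val_inv_eq_inv_val, map_inv₀]
      exact inv_lt_one_of_one_lt₀ hgt
    have : V (↑C.u⁻¹ : ℚ_[p]) ^ 12 < 1 := pow_lt_one₀ zero_le hinv (by norm_num)
    exact absurd h1 (not_le.mpr this)
  -- `C.u = Cd.u` viewed in `ℚ_p`; a `p`-adic integer has non-negative `ord_p`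
  have hCu : (C.u : ℚ_[p]) = ((Cd.u : ℚ) : ℚ_[p]) := by
    rw [hC]; simp [VariableChange.map]
  rw [hCu] at hVu
  obtain ⟨z, hz⟩ := (WeierstrassCurve.valuation_maximalIdeal_le_one_iff_mem_range (R := ℤ_[p]) _).mp hVu
  have hnorm : ‖((Cd.u : ℚ) : ℚ_[p])‖ ≤ 1 := by rw [← hz]; exact PadicInt.norm_le_one z
  have hval := (Padic.norm_le_one_iff_val_nonneg _).mp hnorm
  rwa [Padic.valuation_ratCast] at hval

/-! ### The twist's algebraic central value from Gross–Zagier I.(7.3) -/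

/-- **`L(E^{d_K},1)/Ω(Wd) ∈ ℚ` from Gross–Zagier I.(7.3) 2) and the Gross–Zagier product formula.**
Data: `W/ℚ` globally minimal of conductor `N` with `ord_{s=1} L(E,s) = 1`; `K` imaginary quadratic with
the Heegner hypothesis for `N` and `L(E^{d_K},1) ≠ 0`; `P ∈ E(K)` the Heegner point of a
parametrisation datum `Dt`; `Wd = Cd • W^{(d_K)}` any model of the twist. PUBLISHED binders: `hGZ`
(Gross–Zagier I.(6.3)), `hKo` (Kolyvagin: rank `E(K) = 1`), `hGZK` (Gross–Zagier–Kolyvagin over `ℚ`: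
rank `E(ℚ) = 1`), `hmod` (modularity: `L(E/K) = L(E)·L(E^{d_K})`), `hGZ73` (Gross–Zagier I.(7.3) 2):
`L'(E,1) = c·Ω_E·Reg(E/ℚ)`, `c ∈ ℚ^×`). CONCLUSION: `L(Wd,1)/Ω(Wd) = 8 I²/(n m c_φ² w² t_K² c |u|) ∈ ℚ`
(`I = [E(K):ℤP]`, `ĥ(P) = 2I²Reg/(m t_K²)`, `‖ω‖²/(u_K²√|d_K|) = 4 Ω_E Ω_{E^d}/(n c_φ² w²)`,
`Ω(Wd) = |u| Ω_{E^d}`). [cite: GrossZagier1986, Thm. I.(7.3) 2) (p. 231) and V.§2 (pp. 310–312)]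
[cite: JetchevSkinnerWan2017, §7.4.1 (eq:gz for K′)] -/
theorem exists_rat_twist_L_one_div_realPeriod_of_heegner
    (W : WeierstrassCurve ℚ) [W.IsElliptic] [W.IsGloballyMinimal]
    (N : ℕ) [NeZero N] (K : Type) [Field K] [NumberField K]
    (Dt : ModularParametrizationData W N) (H : HeegnerDatum N (NumberField.discr K)) (ι : K →+* ℂ)
    (P : (W.baseChange K).toAffine.Point)
    -- the published inputs (named facts of the tree)
    (hGZ : gross_zagier N W K) (hKo : kolyvagin N W K)
    (hGZK : rank_eq_analyticRank_of_analyticRank_le_one) (hmod : hasEntireLFunction_rat)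
    (hGZ73 : GrossZagier1986_thm_I_7_3)
    -- the data
    (hK : IsImaginaryQuadratic K) (hHN : SatisfiesHeegnerHypothesis N K)
    (hP : WeierstrassCurve.Affine.Point.map ι.toRatAlgHom P = heegnerPointComplex Dt H)
    (hr : W.analyticRank = 1)
    (hLt : (W.quadraticTwist (NumberField.discr K : ℚ)).entireLFunction 1 ≠ 0)
    (Wd : WeierstrassCurve ℚ) [Wd.IsElliptic] (Cd : VariableChange ℚ)
    (hWd : Cd • W.quadraticTwist (NumberField.discr K : ℚ) = Wd) :
    ∃ qd : ℚ, Wd.entireLFunction 1 / (Wd.realPeriodRat : ℂ) = (qd : ℂ) := by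
  haveI hEK : (W.baseChange K).IsElliptic := isElliptic_baseChange' W K
  obtain ⟨h2, hKtc⟩ := hK
  haveI : IsTotallyComplex K := hKtc
  have hD0 : (NumberField.discr K : ℚ) ≠ 0 := by exact_mod_cast NumberField.discr_ne_zero K
  haveI hEt : (W.quadraticTwist (NumberField.discr K : ℚ)).IsElliptic :=
    W.isElliptic_quadraticTwist hD0
  have hc0 : Dt.c ≠ 0 := Dt.maninConstant_ne_zero_holds
  ---------------------------------------------------------------- `L`-values over `ℚ` and `K`
  have hL0 : W.entireLFunction 1 = 0 := entireLFunction_one_eq_zero_of_analyticRank_eq_one hr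
  obtain ⟨-, hderiv⟩ := leadingLCoeff_eq_deriv_of_analyticRank_eq_one hr
  have hprod := lDerivEK_eq_deriv_mul W K hmod hL0
  have hLK : LDerivEK W K ≠ 0 := by
    rw [hprod]; exact mul_ne_zero hderiv hLt
  ---------------------------------------------------------------- ranks: Kolyvagin over `K`, GZK over `ℚ`
  have hPH : IsHeegnerPoint N W K P := ⟨Dt, H, ι, hP⟩
  have hPinf : ¬ IsOfFinAddOrder P :=
    (lDerivEK_ne_zero_iff_not_isOfFinAddOrder W N K hGZ ⟨h2, hKtc⟩ hHN hPH).mp hLK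
  obtain ⟨hrkK, -⟩ := hKo ⟨h2, hKtc⟩ hHN hPH hPinf
  have hrQ : W.mordellWeilRank = 1 := by rw [(hGZK W (le_of_eq hr)).1, hr]
  ---------------------------------------------------------------- Gross–Zagier I.(7.3) 2): `L'(E,1) = c Ω R`
  obtain ⟨c, hc, hL1⟩ := hGZ73.exists_rat_of_mordellWeilRank_eq_one hL0 hderiv hrQ
  ---------------------------------------------------------------- heights/index, Gross–Zagier, periods
  obtain ⟨m, hm, hheight⟩ :=
    exists_mul_canonicalHeight_eq_index_sq_mul_regulator W K h2 hrkK hrQ P hPinf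
  have hLD := (hGZ ⟨h2, hKtc⟩ hHN) Dt H ι P hP
  have hper := two_mul_covolume_div_sqrt_eq_bsdPeriod W K Dt h2
  have hΩ := W.realPeriod_mul_realPeriod_quadraticTwist_eq_mul_bsdPeriod K h2
  have hΩd : Wd.realPeriodRat =
      |((Cd.u : ℚ) : ℝ)| * (W.quadraticTwist (NumberField.discr K : ℚ)).realPeriodRat := by
    rw [← hWd]; exact realPeriodRat_smul_holds (W.quadraticTwist _) Cd
  have hLt' : (W.quadraticTwist (NumberField.discr K : ℚ)).entireLFunction = Wd.entireLFunction := by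
    rw [← hWd, entireLFunction_smul]
  ---------------------------------------------------------------- positivity
  have hΩW : 0 < W.realPeriodRat := W.realPeriodRat_pos_holds
  have hΩt : 0 < (W.quadraticTwist (NumberField.discr K : ℚ)).realPeriodRat :=
    (W.quadraticTwist _).realPeriodRat_pos_holds
  have hR : 0 < W.regulator := W.regulator_pos'
  have htK : 0 < (W.baseChange K).torsionOrder := (W.baseChange K).torsionOrder_pos_holds
  have hw : 0 < Units.torsionOrder K := Units.torsionOrder_pos K
  have huu : (Cd.u : ℚ) ≠ 0 := Cd.u.ne_zero
  have hm0 : 0 < m := by rcases hm with rfl | rfl <;> norm_num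
  set n := (W.baseChange ℝ).numRealComponents with hn_def
  have hn : n = 1 ∨ n = 2 := numRealComponents_eq_one_or W
  have hn0 : 0 < n := by rcases hn with h' | h' <;> omega
  ---------------------------------------------------------------- abbreviations
  set I := (AddSubgroup.zmultiples P).index with hI_def
  set ΩW := W.realPeriodRat with hΩW_def
  set Ωt := (W.quadraticTwist (NumberField.discr K : ℚ)).realPeriodRat with hΩt_def
  set B := (W.baseChange K).bsdPeriod with hB_def
  set R := W.regulator with hR_def
  set hh := P.canonicalHeight with hhh_def
  set tK := (W.baseChange K).torsionOrder with htK_def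
  set w := Units.torsionOrder K with hw_def
  set cM := Dt.c with hcM_def
  set u := (Cd.u : ℚ) with hu_def
  have hΩW' : ΩW = (W.baseChange ℝ).realPeriod := rfl
  have hΩt' : Ωt = ((W.quadraticTwist (NumberField.discr K : ℚ)).baseChange ℝ).realPeriod := rfl
  rw [← hΩW', ← hΩt'] at hΩ
  have hBeq : B = ΩW * Ωt / n := by
    rw [hΩ]; field_simp
  have hheq : hh = 2 * (I : ℝ) ^ 2 * R / ((m : ℝ) * (tK : ℝ) ^ 2) := by
    rw [← hheight]; field_simp
  have hGZc : 2 * ZLattice.covolume Dt.L.lattice /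
        ((cM : ℝ) ^ 2 * ((w : ℝ) / 2) ^ 2 * √|(NumberField.discr K : ℝ)|) =
      4 * B / ((cM : ℝ) ^ 2 * (w : ℝ) ^ 2) := by
    rw [← hper]; field_simp; ring
  ---------------------------------------------------------------- the rational value
  set qd : ℚ := 8 * (I : ℚ) ^ 2 /
      ((n : ℚ) * (m : ℚ) * (cM : ℚ) ^ 2 * (w : ℚ) ^ 2 * (tK : ℚ) ^ 2 * c * |u|) with hqd_def
  refine ⟨qd, ?_⟩
  -- `L'(E,1) · L(Wd,1) = (4B/(c_φ² w²)) ĥ(P)` and `L'(E,1) = c Ω_E R ≠ 0`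
  have key : deriv W.entireLFunction 1 * Wd.entireLFunction 1 =
      ((4 * B / ((cM : ℝ) ^ 2 * (w : ℝ) ^ 2) * hh : ℝ) : ℂ) := by
    rw [← hLt', ← hprod, hLD, hGZc]
  have hcΩR : ((c : ℝ) * ΩW * R : ℝ) ≠ 0 := by
    have hc' : (c : ℝ) ≠ 0 := by exact_mod_cast hc
    exact mul_ne_zero (mul_ne_zero hc' hΩW.ne') hR.ne'
  have hL1' : deriv W.entireLFunction 1 = (((c : ℝ) * ΩW * R : ℝ) : ℂ) := hL1
  have hLd : Wd.entireLFunction 1 =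
      (((4 * B / ((cM : ℝ) ^ 2 * (w : ℝ) ^ 2) * hh) / ((c : ℝ) * ΩW * R) : ℝ) : ℂ) := by
    have hne : ((((c : ℝ) * ΩW * R : ℝ)) : ℂ) ≠ 0 := by exact_mod_cast hcΩR
    rw [Complex.ofReal_div, eq_div_iff hne, mul_comm, ← hL1', key]
  have hΩdC : (Wd.realPeriodRat : ℂ) = ((|(u : ℝ)| * Ωt : ℝ) : ℂ) := by
    rw [hΩd]
  rw [hLd, hΩdC, ← Complex.ofReal_div]
  have hreal : (4 * B / ((cM : ℝ) ^ 2 * (w : ℝ) ^ 2) * hh) / ((c : ℝ) * ΩW * R) / (|(u : ℝ)| * Ωt) =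
      (qd : ℝ) := by
    have hn' : (n : ℝ) ≠ 0 := by exact_mod_cast hn0.ne'
    have hm' : (m : ℝ) ≠ 0 := by exact_mod_cast hm0.ne'
    have htK' : (tK : ℝ) ≠ 0 := by exact_mod_cast htK.ne'
    have hcM' : (cM : ℝ) ≠ 0 := by exact_mod_cast hc0
    have hw' : (w : ℝ) ≠ 0 := by exact_mod_cast hw.ne'
    have hu' : |(u : ℝ)| ≠ 0 := abs_ne_zero.mpr (by exact_mod_cast huu)
    have hc' : (c : ℝ) ≠ 0 := by exact_mod_cast hc
    rw [hheq, hBeq, hqd_def]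
    push_cast
    field_simp
    ring
  rw [hreal]
  norm_cast

end Summit.BirchSwinnertonDyer.BirchSwinnertonDyer.Theorems.SchneiderFree

end
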